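import Literature.MathematicalPhysics.QuantumFieldTheory.Balaban1983to89.B9Thm37GlueTorusCovTowerDir

/-!
# `Balaban1983to89.B9Thm37GlueTorusCovTowerPU` — THE TOWER OPERATOR IN THE (3.87)–(3.88) ALGEBRA OF THE CHAIN:
# the level sum commutes with multiplication by functions constant on the blocks; the tower operator is LOCAL on
# regions that are unions of top-level blocks; `hloc` — h_□Δ′G′_□h_□ = h²_□ — is DISCHARGED for the tower's OWN
# Dirichlet inverses G′_□; and the printed-shape identity Δ′G′₀ = I − Σ_□K(h_□)G′_□h_□ with G′₀ = Σ_□h_□G′_□h_□ holds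
# for every partition of unity Σ_□h²_□ = 1 carried by covered block-hull regions, with K(h) CONCRETE — on the torus
# for the lineage's partition of unity `hSU` of [3] (1.118)
# (MODEL; own lineage pv21; imports `B9Thm37GlueTorusCovTowerDir` only; modifies nothing)

References (bib keys; the tags below cite only these):
* [B9] = `Balaban1985BackgroundPropagators` — T. Bałaban, *Propagators for lattice gauge theories in a background
  field*, Commun. Math. Phys. 99 (1985) 389–434.
* [4] = `Balaban1984PropagatorsII` — T. Bałaban, *Propagators and renormalization transformations for lattice gauge
  theories. II*, Commun. Math. Phys. 96 (1984) 223–250 (only NAMED, through `B9Thm37Glue`).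
* [3] = `Balaban1984PropagatorsI` — T. Bałaban, *Propagators and renormalization transformations for lattice gauge
  theories. I*, Commun. Math. Phys. 95 (1984) 17–40 (only NAMED: (1.118), the partition of unity, through
  `B9Thm37GluePU` / `B5SmoothPartition`).

THE PRINTED LOCI.  NO new «» span in this file; everything printed is only NAMED and is certified in the headers of
modules in the import closure: [B9] (3.87)–(3.88) pp. 408–409 and p. 408 "Σ_□ h²_□ = 1" (`B9Thm37Sum`,
`B9Thm37Glue` v7), (3.16) p. 393 (`B9Thm37GlueTorusCovLevels`), (3.15)/(3.18)–(3.19) p. 393 (`B9Thm37GlueTorusCov`,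
`B9Thm37GlueTorusCovComp`), (3.3) pp. 390–391 (∇_U, `B9Thm37Glue`), (3.23)–(3.24) p. 394 and p. 394 (Ω₀Δ′_aΩ₀, G′;
`B9Thm37Glue`, `B9Thm37GlueTorusInv`), p. 408 (Ω₀(□) between □̃⁴ and □̃⁵ — named only; NOT modelled, see the
honest scope), (3.90) p. 409 (`B9Thm37Sum.fixedPoint_of_388`); [4] (2.39)–(2.40) pp. 229–230 (`B9Thm37Glue`);
[3] (1.118) p. 36 (`B5SmoothPartition`, `B9Thm37GluePU`).  NOTHING printed is asserted as a theorem — every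
declaration below is a kernel-checked statement about the component MODEL of the lineage.

THE POINT (value = a MODEL kernel certificate steering the lineage; NOT summit progress).  The chain's (3.87)–(3.88)
algebra (`B9Thm37Sum.eq388_sum`, `B9Thm37Glue.h388_lattice`) takes the averaging part Q′\*aQ′ of Δ′_a as an ABSTRACT
operator `Qf` and the local inverse property `hloc` (h_□Δ′_aG′_□h_□ = h²_□) as a HYPOTHESIS; `B9Thm37GlueTorusInv`
§2/§5–§6 discharged `hloc` only for the DIAGONAL mass Δ_U + M_q.  THIS FILE discharges it for the printed-shape
operator of the level files — the (k+1)-level tower operator Δ′ = Δ_U + Σ_{l≤k} a_l G_lᵀG_l of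
`B9Thm37GlueTorusCovTower` — with its OWN Dirichlet inverses of `B9Thm37GlueTorusCovTowerDir`:
 * §1 GENERIC (any blocking map).  `gMeanSq_comm_mulOp`: a block term GᵀG (G = the covariant block mean `gMean blk W T`
   of `B9Thm37GlueTorusCovComp`, arbitrary site weights and site transports) COMMUTES with M_χ for every χ constant
   on the blocks (kernel computation); `levelSum_comm_mulOp`: so does the level sum Σ_j a_j G_jᵀG_j for χ constant on
   every level's blocks.
 * §2 THE TOWER.  `towerBlk_eq_of_le`: tower blocks are NESTED (same level-l block ⇒ same level-m block, l ≤ m), so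
   a χ constant on the level-k blocks is constant on all lower blocks (`towerLevelSum_comm_mulOp`);
   `towerOp_def` (Δ′ = D\*D + level sum, rfl), `towerK` + **`towerOp_mul_mulOp`** ((3.88) first equality for Δ′:
   Δ′M_h = M_hΔ′ − K(h) with K(h) = (leibRemT h)D − D\*(leibRem h) + [M_h, level sum] CONCRETE —
   `B9Thm37Glue.covLapQ_mul_mulOp`); **`towerOp_local`**: M_hΔ′M_χ = M_hΔ′ whenever hχ = h, χ is constant on the
   level-k blocks and D\*D does not couple supp h to {χ ≠ 1} (hypothesis `hD`; on the torus it is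
   `B9Thm37GlueTorusInv.mulOp_hSU_covLapQ_mulOp`); **`hloc_tower`**: then, for Ω₀ = {χ = 1} covered by the levels
   (χ {0,1}-valued), h·Δ′·G′_Ω₀·h = h² with G′_Ω₀ := `dirInv Δ′ Ω₀` (`towerDir_right` + `hloc_of_dirichlet`).
   `blkHull` (the level-k block hull of the support of a function: {0,1}-valued, = 1 on the support, constant on
   level-k blocks) supplies such χ.
 * §3 (3.87)–(3.88) FOR THE TOWER OPERATOR.  **`eq388_tower`**: for EVERY finite family h_i with Σ_i h_i² = 1 and
   regions Ω_i = {χ_i = 1} ({0,1}-valued, constant on level-k blocks, h_iχ_i = h_i, D\*D-local, each covered by the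
   levels): Δ′·(Σ_i h_iG′_ih_i) = 1 − Σ_i K(h_i)G′_ih_i with G′_i := dirInv Δ′ Ω_i — `h388_lattice` with NO abstract
   input left except the cover; **`fixedPoint_tower`**: the regions then cover everything, Δ′ is a unit, and
   G′ = G′₀ + G′R′ for G′ = Δ′⁻¹, G′₀ = Σ_i h_iG′_ih_i, R′ = Σ_i K(h_i)G′_ih_i ((3.90) shape, `fixedPoint_of_388`).
 * §4 THE TORUS `UT N` with the lineage's partition of unity h_z = `hSU N M₀ z` of [3] (1.118) (Σ_z h_z² = 1 EXACT,
   `B9Thm37GluePU.hsq_torus`; M₀ ∣ N_i, 2M₀ ≤ N_i), cube-comb tower of sides M_j, regions Ω₀(z) := `omegaBall` = the `blkHull` of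
   the (M₀+1)-ball round the centre z (`B9Thm37GlueTorusInv.chiBall`), D\*D-locality `hD_torus` from
   `B9Thm37GlueTorusInv.mulOp_hSU_covLapQ_mulOp`: **`eq388_tower_torus`** and **`fixedPoint_tower_torus`** — the
   only hypothesis beyond the data is the cover of each Ω₀(z) by the levels — and NONE AT ALL in the uniform-weight regime
   (block weights constant on each level, top level switched on: `eq388_tower_torus_top`, `fixedPoint_tower_torus_top`;
   v1.1 addendum).

NOT ASSERTED, NOT MODELLED (honest scope).  (i) ALGEBRA + EXISTENCE ONLY: the identities are exact operator
identities and every G′_□ is a genuine (two-sided, supported, symmetric, positive, ℓ²-bounded — `…CovTowerDir`)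
Dirichlet inverse of the printed-shape operator; but NO SMALLNESS of R′ = Σ_□K(h_□)G′_□h_□ is claimed — that is
the content of [B9] (3.89)/Theorem 3.7 and needs the decay of G′_□ and the ∂h_□ bounds, neither of which is
available for the tower operator (ℓ² only, honest scope of `…CovTowerDir`); hence nothing of (3.89)–(3.91), of the
convergence of Σ R′ⁿ, of Theorems 3.1–3.3 / Corollary 3.6 / Theorem 3.7.  (ii) The regions are SHARP block hulls
({0,1}-valued Ω₀); print's Ω₀(□) (p. 408, □̃⁴ ⊂ Ω₀(□) ⊂ □̃⁵, a union of big cubes) is named only — the common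
feature modelled is "a union of top-level blocks containing a neighbourhood of supp h_□".  (iii) As in the import
closure: Ū of [B7] (42)–(43) NOT constructed, crude constants, component site fields, no decay.
Value = MODEL kernel certificate, NOT summit progress; NOT continuum, NOT Clay, NOT a claim about print.
-/

namespace Literature.MathematicalPhysics.QuantumFieldTheory.Balaban1983to89.B9Thm37GlueTorusCovTowerPU

open Finset B9Thm37Sum B9Thm37Glue B9Thm37GlueTorusInv B9Thm37GlueTorusCov B9Thm37GlueTorusCovComp
  B9Thm37GlueTorusCovPoinc B9Thm37GlueTorusCovLevels B9Thm37GlueTorusCovLevelsPoinc B9Thm37GlueTorusCovLevelsTower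
  B9Thm37GlueTorusCovTower B9Thm37GlueTorusCovTowerDir
open B5TorusCover (UT Ctr ctrU)
open B5SmoothPartition (hSU)

noncomputable section

/-! ## §1  Generic: block terms commute with multiplication by block-constant functions -/

section Generic

variable {St B Cp : Type} [Fintype St] [DecidableEq B] [Fintype Cp]

/-- The covariant block mean of χ·f is χ̃·(mean of f) when χ is constant on the blocks (χ̃ = the common value):
(G(M_χ f))(blk x, i) = χ(x)·(Gf)(blk x, i).  Kernel computation (every W, T). [folklore] -/
theorem gMean_mulOp_blockConst (blk : St → B) (W : St → ℝ) (T : St → Cp → Cp → ℝ) {χ : St → ℝ}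
    (hconst : ∀ x x', blk x = blk x' → χ x = χ x') (f : St × Cp → ℝ) (x : St) (i : Cp) :
    gMean blk W T (mulOp (χ ∘ Prod.fst) f) (blk x, i) = χ x * gMean blk W T f (blk x, i) := by
  rw [gMean_apply, gMean_apply, Finset.mul_sum]
  refine Finset.sum_congr rfl fun x' _ => ?_
  split_ifs with hb
  · simp only [mulOp_apply, Function.comp_apply]
    rw [hconst x' x hb]
    simp only [Finset.mul_sum]
    exact Finset.sum_congr rfl fun j _ => by ring
  · rw [mul_zero]

/-- **A BLOCK TERM GᵀG COMMUTES WITH M_χ FOR χ CONSTANT ON THE BLOCKS** (G = `gMean blk W T`, any site weights and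
site transports): M_χGᵀG = GᵀGM_χ. [cite: Balaban1985BackgroundPropagators, (3.16) p.393 + (3.88) p.409 (the [M_h, Q′\*aQ′] term)] -/
theorem gMeanSq_comm_mulOp (blk : St → B) (W : St → ℝ) (T : St → Cp → Cp → ℝ) {χ : St → ℝ}
    (hconst : ∀ x x', blk x = blk x' → χ x = χ x') :
    mulOp (χ ∘ Prod.fst) * (gMeanT blk W T ∘ₗ gMean blk W T) =
      (gMeanT blk W T ∘ₗ gMean blk W T) * mulOp (χ ∘ Prod.fst) := by
  refine LinearMap.ext fun f => funext fun p => ?_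
  obtain ⟨x, j⟩ := p
  simp only [Module.End.mul_apply, LinearMap.comp_apply, mulOp_apply, Function.comp_apply, gMeanT_apply]
  simp_rw [gMean_mulOp_blockConst blk W T hconst f x]
  simp only [Finset.mul_sum]
  exact Finset.sum_congr rfl fun i _ => by ring

variable {J : Type} [Fintype J]

/-- **THE LEVEL SUM Σ_j a_j G_jᵀG_j COMMUTES WITH M_χ FOR χ CONSTANT ON EVERY LEVEL'S BLOCKS.**
[cite: Balaban1985BackgroundPropagators, (3.16) p.393 + (3.88) p.409] -/
theorem levelSum_comm_mulOp (blk : J → St → B) (W : J → St → ℝ) (T : J → St → Cp → Cp → ℝ) (a : J → ℝ)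
    {χ : St → ℝ} (hconst : ∀ j x x', blk j x = blk j x' → χ x = χ x') :
    mulOp (χ ∘ Prod.fst) * levelSum blk W T a = levelSum blk W T a * mulOp (χ ∘ Prod.fst) := by
  rw [levelSum, Finset.mul_sum, Finset.sum_mul]
  refine Finset.sum_congr rfl fun j _ => ?_
  rw [mul_smul_comm, smul_mul_assoc, gMeanSq_comm_mulOp (blk j) (W j) (T j) (hconst j)]

end Generic

/-! ## §2  The tower: nested blocks, locality of Δ′ on block-hull regions, `hloc` discharged -/

section Tower

variable {St Bd Cp : Type} [Fintype St] [DecidableEq St] [Fintype Bd] [Fintype Cp] [DecidableEq Cp]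
  {src tgt : Bd → St} {Bs : ℕ → Type} [∀ j, Fintype (Bs j)] [∀ j, DecidableEq (Bs j)]
  (Ks : ∀ j, Comb src tgt (Bs j)) (Rm : Bd → Cp → Cp → ℝ)

omit [Fintype St] [DecidableEq St] [Fintype Bd] [Fintype Cp] [DecidableEq Cp] [∀ j, Fintype (Bs j)]
  [∀ j, DecidableEq (Bs j)] in
/-- **Tower blocks are nested**: two sites with the same level-l block have the same level-m block for every m ≥ l
(level m+1 = comb K_m applied to level m). [cite: Balaban1985BackgroundPropagators, (3.19) p.393] -/
theorem towerBlk_eq_of_le {l m : ℕ} (hlm : l ≤ m) {x x' : St} (h : towerBlk Ks l x = towerBlk Ks l x') :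
    towerBlk Ks m x = towerBlk Ks m x' := by
  obtain ⟨n, rfl⟩ := Nat.exists_eq_add_of_le hlm
  induction n with
  | zero => simpa using h
  | succ n ih =>
      rw [← Nat.add_assoc, towerBlk_succ, towerBlk_succ, ih (Nat.le_add_right l n)]

omit [Fintype St] [DecidableEq St] [Fintype Bd] [Fintype Cp] [DecidableEq Cp] [∀ j, Fintype (Bs j)]
  [∀ j, DecidableEq (Bs j)] in
/-- A function constant on the level-k blocks is constant on the level-l blocks for every l ≤ k. [folklore] -/
theorem blockConst_of_le {k : ℕ} {χ : St → ℝ} (hconst : ∀ x x', towerBlk Ks k x = towerBlk Ks k x' → χ x = χ x')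
    (l : Fin (k + 1)) (x x' : St) (h : towerBlk Ks (l : ℕ) x = towerBlk Ks (l : ℕ) x') : χ x = χ x' :=
  hconst x x' (towerBlk_eq_of_le Ks (Nat.le_of_lt_succ l.isLt) h)

omit [Fintype Bd] [∀ j, Fintype (Bs j)] [∀ j, DecidableEq (Bs j)] in
/-- **The tower's level sum commutes with M_χ for χ constant on the level-k blocks** (any weights, any transports,
any a). [cite: Balaban1985BackgroundPropagators, (3.16) p.393 + (3.88) p.409] -/
theorem towerLevelSum_comm_mulOp (k : ℕ) (W : Fin (k + 1) → St → ℝ) (a : Fin (k + 1) → ℝ) {χ : St → ℝ}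
    (hconst : ∀ x x', towerBlk Ks k x = towerBlk Ks k x' → χ x = χ x') :
    mulOp (χ ∘ Prod.fst) *
        levelSum (fun l : Fin (k + 1) => towerBlk Ks (l : ℕ)) W (fun l => towerTr Ks Rm (l : ℕ)) a =
      levelSum (fun l : Fin (k + 1) => towerBlk Ks (l : ℕ)) W (fun l => towerTr Ks Rm (l : ℕ)) a *
        mulOp (χ ∘ Prod.fst) :=
  levelSum_comm_mulOp _ W _ a (blockConst_of_le Ks hconst)

omit [∀ j, Fintype (Bs j)] [∀ j, DecidableEq (Bs j)] in
/-- Unfolding: the tower operator is D\*D + the tower's level sum. [cite: Balaban1985BackgroundPropagators, (3.16) p.393 + (3.23)–(3.24) p.394] -/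
theorem towerOp_def (c : Bd → ℝ) (k : ℕ) (W : Fin (k + 1) → St → ℝ) (a : Fin (k + 1) → ℝ) :
    towerOp Ks Rm c k W a = covDT src tgt c Rm ∘ₗ covD src tgt c Rm +
      levelSum (fun l : Fin (k + 1) => towerBlk Ks (l : ℕ)) W (fun l => towerTr Ks Rm (l : ℕ)) a := rfl

/-- MODEL of K(h) of (3.88) for the tower operator, CONCRETE: K(h) = (leibRemT h)∘D − D\*∘(leibRem h) + [M_h, level
sum] (the D-part = the lattice Leibniz rules of `B9Thm37Glue` v3/v5; the averaging part = the commutator of M_h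
with Σ_{l≤k} a_l G_lᵀG_l — print's second display line of (3.88), [4] (2.40) third term).
[cite: Balaban1985BackgroundPropagators, (3.88) p.409; Balaban1984PropagatorsII, (2.39)–(2.40) pp.229–230] -/
def towerK (c : Bd → ℝ) (k : ℕ) (W : Fin (k + 1) → St → ℝ) (a : Fin (k + 1) → ℝ) (h : St → ℝ) :
    Module.End ℝ (St × Cp → ℝ) :=
  leibRemT src tgt c h ∘ₗ covD src tgt c Rm +
    (-(covDT src tgt c Rm ∘ₗ leibRem src tgt c h) +
      (mulOp (h ∘ Prod.fst) *
          levelSum (fun l : Fin (k + 1) => towerBlk Ks (l : ℕ)) W (fun l => towerTr Ks Rm (l : ℕ)) a -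
        levelSum (fun l : Fin (k + 1) => towerBlk Ks (l : ℕ)) W (fun l => towerTr Ks Rm (l : ℕ)) a *
          mulOp (h ∘ Prod.fst)))

omit [∀ j, Fintype (Bs j)] [∀ j, DecidableEq (Bs j)] in
/-- **(3.88), FIRST EQUALITY, FOR THE TOWER OPERATOR**: Δ′M_h = M_hΔ′ − K(h) with K(h) = `towerK … h` CONCRETE
(every c, transport, weights, a, h) — `B9Thm37Glue.covLapQ_mul_mulOp` with Q := the tower's level sum.
[cite: Balaban1985BackgroundPropagators, (3.88) p.409 + (3.16) p.393; Balaban1984PropagatorsII, (2.39)–(2.40) pp.229–230] -/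
theorem towerOp_mul_mulOp (c : Bd → ℝ) (k : ℕ) (W : Fin (k + 1) → St → ℝ) (a : Fin (k + 1) → ℝ) (h : St → ℝ) :
    towerOp Ks Rm c k W a * mulOp (h ∘ Prod.fst) =
      mulOp (h ∘ Prod.fst) * towerOp Ks Rm c k W a - towerK Ks Rm c k W a h :=
  covLapQ_mul_mulOp src tgt c Rm _ h

omit [∀ j, Fintype (Bs j)] [∀ j, DecidableEq (Bs j)] in
/-- **LOCALITY OF THE TOWER OPERATOR ON BLOCK-HULL REGIONS**: if hχ = h, χ is constant on the level-k blocks, and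
D\*D does not couple supp h to {χ ≠ 1} (`hD`), then M_hΔ′M_χ = M_hΔ′ (the level sum commutes with M_χ,
`towerLevelSum_comm_mulOp`, and M_hM_χ = M_h). [cite: Balaban1985BackgroundPropagators, (3.16) p.393 + (3.23) p.394 + p.408 (Ω₀(□))] -/
theorem towerOp_local (c : Bd → ℝ) (k : ℕ) (W : Fin (k + 1) → St → ℝ) (a : Fin (k + 1) → ℝ) {h χ : St → ℝ}
    (h1 : ∀ x, h x * χ x = h x) (hconst : ∀ x x', towerBlk Ks k x = towerBlk Ks k x' → χ x = χ x')
    (hD : mulOp (h ∘ Prod.fst) * (covDT src tgt c Rm ∘ₗ covD src tgt c Rm) * mulOp (χ ∘ Prod.fst) =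
      mulOp (h ∘ Prod.fst) * (covDT src tgt c Rm ∘ₗ covD src tgt c Rm)) :
    mulOp (h ∘ Prod.fst) * towerOp Ks Rm c k W a * mulOp (χ ∘ Prod.fst) =
      mulOp (h ∘ Prod.fst) * towerOp Ks Rm c k W a := by
  have h1' : ∀ p : St × Cp, (h ∘ Prod.fst) p * (χ ∘ Prod.fst) p = (h ∘ Prod.fst) p := fun p => h1 p.1
  rw [towerOp_def, mul_add, add_mul, hD, mul_assoc (mulOp (h ∘ Prod.fst)) (levelSum _ W _ a),
    ← towerLevelSum_comm_mulOp Ks Rm k W a hconst, ← mul_assoc, mulOp_mul_mulOp_of_mul_eq h1']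

/-- **`hloc` DISCHARGED FOR THE TOWER OPERATOR'S OWN DIRICHLET INVERSE**: with Ω₀ = {χ = 1} (χ {0,1}-valued,
constant on the level-k blocks, hχ = h, D\*D-local at supp h) COVERED by the levels (every site of Ω₀ has some
level l ≤ k with a_l ≥ a_min > 0 and block weight of modulus ≥ w_min > 0), the Dirichlet inverse
G′_Ω₀ := `dirInv Δ′ Ω₀` of `B9Thm37GlueTorusCovTowerDir` satisfies h·Δ′·G′_Ω₀·h = h² — the located identity
behind (3.88) for the printed-shape operator, NOT assumed but proved (`towerDir_right` + `hloc_of_dirichlet`).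
[cite: Balaban1985BackgroundPropagators, (3.88) p.409 + p.394 (Ω₀Δ′_aΩ₀, G′) + (3.16) p.393] -/
theorem hloc_tower (hRm : ∀ b i j, ∑ k, Rm b k i * Rm b k j = if i = j then (1 : ℝ) else 0)
    {c : Bd → ℝ} {cmin : ℝ} (hcmin : 0 < cmin) (hc : ∀ b, cmin ≤ |c b|) {D n : ℕ → ℕ}
    (hDp : ∀ j x, (Ks j).depth x ≤ D j) (hn : ∀ j β, (univ.filter fun x => (Ks j).blk x = β).card ≤ n j)
    (k : ℕ) (w : Fin (k + 1) → St → ℝ) {a : Fin (k + 1) → ℝ} (ha : ∀ l, 0 ≤ a l) {amin wmin : ℝ}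
    (hamin : 0 < amin) (hwmin : 0 < wmin) {h χ : St → ℝ} (hχ : ∀ x, χ x = 0 ∨ χ x = 1)
    (h1 : ∀ x, h x * χ x = h x) (hconst : ∀ x x', towerBlk Ks k x = towerBlk Ks k x' → χ x = χ x')
    (hD : mulOp (h ∘ Prod.fst) * (covDT src tgt c Rm ∘ₗ covD src tgt c Rm) * mulOp (χ ∘ Prod.fst) =
      mulOp (h ∘ Prod.fst) * (covDT src tgt c Rm ∘ₗ covD src tgt c Rm))
    (hcov : ∀ x, χ x = 1 → ∃ l : Fin (k + 1), amin ≤ a l ∧ wmin ≤ |w l (towerBlk Ks (l : ℕ) x)|) :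
    mulOp (h ∘ Prod.fst) * towerOp Ks Rm c k (fun l x => w l (towerBlk Ks (l : ℕ) x)) a *
        dirInv (towerOp Ks Rm c k (fun l x => w l (towerBlk Ks (l : ℕ) x)) a) (χ ∘ Prod.fst) *
        mulOp (h ∘ Prod.fst) = mulOp (h ∘ Prod.fst) * mulOp (h ∘ Prod.fst) :=
  hloc_of_dirichlet
    (towerDir_right Ks Rm hRm hcmin hc hDp hn k w ha hamin hwmin (fun p => hχ p.1) fun x _ hx => hcov x hx)
    (fun p => h1 p.1) (towerOp_local Ks Rm c k _ a h1 hconst hD)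

omit [Fintype Bd] [Fintype Cp] [DecidableEq Cp] [∀ j, Fintype (Bs j)] [∀ j, DecidableEq (Bs j)] in
open Classical in
/-- MODEL: the LEVEL-k BLOCK HULL of the support of ρ — the indicator of the union of the level-k blocks meeting
{ρ ≠ 0} (one admissible Ω₀ for a function carried by {ρ ≠ 0}; print's Ω₀(□) is a union of big cubes, p. 408 —
named only). [cite: Balaban1985BackgroundPropagators, p.408 (Ω₀(□))] -/
def blkHull (k : ℕ) (ρ : St → ℝ) : St → ℝ :=
  fun x => if ∃ x', ρ x' ≠ 0 ∧ towerBlk Ks k x' = towerBlk Ks k x then 1 else 0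

omit [Fintype Bd] [Fintype Cp] [DecidableEq Cp] [∀ j, Fintype (Bs j)] [∀ j, DecidableEq (Bs j)] in
/-- The block hull is {0,1}-valued. [folklore] -/
theorem blkHull_zero_or_one (k : ℕ) (ρ : St → ℝ) (x : St) : blkHull Ks k ρ x = 0 ∨ blkHull Ks k ρ x = 1 := by
  unfold blkHull
  split_ifs
  · exact Or.inr rfl
  · exact Or.inl rfl

omit [Fintype Bd] [Fintype Cp] [DecidableEq Cp] [∀ j, Fintype (Bs j)] [∀ j, DecidableEq (Bs j)] in
/-- The block hull is 1 on the support of ρ. [folklore] -/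
theorem blkHull_eq_one (k : ℕ) {ρ : St → ℝ} {x : St} (hx : ρ x ≠ 0) : blkHull Ks k ρ x = 1 := by
  unfold blkHull
  rw [if_pos ⟨x, hx, rfl⟩]

omit [Fintype Bd] [Fintype Cp] [DecidableEq Cp] [∀ j, Fintype (Bs j)] [∀ j, DecidableEq (Bs j)] in
/-- The block hull is constant on the level-k blocks. [folklore] -/
theorem blkHull_const (k : ℕ) (ρ : St → ℝ) (x x' : St) (h : towerBlk Ks k x = towerBlk Ks k x') :
    blkHull Ks k ρ x = blkHull Ks k ρ x' := by
  unfold blkHull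
  rw [h]

end Tower

/-! ## §3  (3.87)–(3.88) for the tower operator with its own Dirichlet inverses, and the fixed-point form -/

section Eq388

variable {St Bd Cp : Type} [Fintype St] [DecidableEq St] [Fintype Bd] [Fintype Cp] [DecidableEq Cp]
  {src tgt : Bd → St} {Bs : ℕ → Type} [∀ j, Fintype (Bs j)] [∀ j, DecidableEq (Bs j)]
  (Ks : ∀ j, Comb src tgt (Bs j)) (Rm : Bd → Cp → Cp → ℝ)

/-- **"Δ′_aG′₀ = I − Σ_□K(h_□)G′_□h_□" FOR THE TOWER OPERATOR WITH ITS OWN DIRICHLET INVERSES** — for EVERY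
finite family h_i with Σ_i h_i² = 1 and regions Ω_i = {χ_i = 1} (χ_i {0,1}-valued, constant on the level-k
blocks, h_iχ_i = h_i, D\*D-local at supp h_i) each covered by the levels: with G′_i := `dirInv Δ′ Ω_i` and
G′₀ = Σ_i h_iG′_ih_i, Δ′G′₀ = 1 − Σ_i K(h_i)G′_ih_i, K CONCRETE (`towerK`).  `B9Thm37Glue.h388_lattice` with its
`hloc` DISCHARGED (`hloc_tower`); no abstract input is left except the cover.
[cite: Balaban1985BackgroundPropagators, (3.87)–(3.88) pp.408–409 + p.394 + (3.16) p.393] -/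
theorem eq388_tower (hRm : ∀ b i j, ∑ k, Rm b k i * Rm b k j = if i = j then (1 : ℝ) else 0)
    {c : Bd → ℝ} {cmin : ℝ} (hcmin : 0 < cmin) (hc : ∀ b, cmin ≤ |c b|) {D n : ℕ → ℕ}
    (hDp : ∀ j x, (Ks j).depth x ≤ D j) (hn : ∀ j β, (univ.filter fun x => (Ks j).blk x = β).card ≤ n j)
    (k : ℕ) (w : Fin (k + 1) → St → ℝ) {a : Fin (k + 1) → ℝ} (ha : ∀ l, 0 ≤ a l) {amin wmin : ℝ}
    (hamin : 0 < amin) (hwmin : 0 < wmin) {ι : Type} [Fintype ι] {hs χs : ι → St → ℝ}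
    (hsq : ∀ x, ∑ i, hs i x ^ 2 = 1) (hχ : ∀ i x, χs i x = 0 ∨ χs i x = 1)
    (h1 : ∀ i x, hs i x * χs i x = hs i x)
    (hconst : ∀ i x x', towerBlk Ks k x = towerBlk Ks k x' → χs i x = χs i x')
    (hD : ∀ i, mulOp (hs i ∘ Prod.fst) * (covDT src tgt c Rm ∘ₗ covD src tgt c Rm) * mulOp (χs i ∘ Prod.fst) =
      mulOp (hs i ∘ Prod.fst) * (covDT src tgt c Rm ∘ₗ covD src tgt c Rm))
    (hcov : ∀ i x, χs i x = 1 → ∃ l : Fin (k + 1), amin ≤ a l ∧ wmin ≤ |w l (towerBlk Ks (l : ℕ) x)|) :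
    towerOp Ks Rm c k (fun l x => w l (towerBlk Ks (l : ℕ) x)) a *
        (∑ i, mulOp (hs i ∘ Prod.fst) *
          dirInv (towerOp Ks Rm c k (fun l x => w l (towerBlk Ks (l : ℕ) x)) a) (χs i ∘ Prod.fst) *
          mulOp (hs i ∘ Prod.fst)) =
      1 - ∑ i, towerK Ks Rm c k (fun l x => w l (towerBlk Ks (l : ℕ) x)) a (hs i) *
        dirInv (towerOp Ks Rm c k (fun l x => w l (towerBlk Ks (l : ℕ) x)) a) (χs i ∘ Prod.fst) *
        mulOp (hs i ∘ Prod.fst) :=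
  h388_lattice src tgt c Rm _ hs _ hsq fun i =>
    hloc_tower Ks Rm hRm hcmin hc hDp hn k w ha hamin hwmin (hχ i) (h1 i) (hconst i) (hD i) (hcov i)

omit [Fintype St] [DecidableEq St] [Fintype Bd] [Fintype Cp] [DecidableEq Cp] [∀ j, Fintype (Bs j)]
  [∀ j, DecidableEq (Bs j)] Ks Rm in
/-- A partition of unity Σ_i h_i² = 1 whose members are carried by the regions {χ_i = 1} (h_iχ_i = h_i) makes the
regions cover every site. [folklore] -/
theorem exists_region_of_pu {ι : Type} [Fintype ι] {hs χs : ι → St → ℝ} (hsq : ∀ x, ∑ i, hs i x ^ 2 = 1)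
    (h1 : ∀ i x, hs i x * χs i x = hs i x) (x : St) : ∃ i, χs i x = 1 := by
  obtain ⟨i, -, hi⟩ := Finset.exists_ne_zero_of_sum_ne_zero (by rw [hsq x]; exact one_ne_zero)
  have hne : hs i x ≠ 0 := fun h0 => hi (by rw [h0, zero_pow two_ne_zero])
  exact ⟨i, (mul_right_inj' hne).mp ((h1 i x).trans (mul_one _).symm)⟩

/-- **THE FIXED-POINT FORM G′ = G′₀ + G′R′ ((3.90) shape) FOR THE TOWER OPERATOR**: under the hypotheses of
`eq388_tower` the regions cover everything, Δ′ is a unit (`isUnit_towerOp`), and with G′ := Δ′⁻¹,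
G′₀ := Σ_i h_iG′_ih_i, R′ := Σ_i K(h_i)G′_ih_i: G′ = G′₀ + G′R′ (`B9Thm37Sum.fixedPoint_of_388`).  NO smallness of R′
is asserted. [cite: Balaban1985BackgroundPropagators, (3.88)–(3.90) p.409 + p.394] -/
theorem fixedPoint_tower (hRm : ∀ b i j, ∑ k, Rm b k i * Rm b k j = if i = j then (1 : ℝ) else 0)
    {c : Bd → ℝ} {cmin : ℝ} (hcmin : 0 < cmin) (hc : ∀ b, cmin ≤ |c b|) {D n : ℕ → ℕ}
    (hDp : ∀ j x, (Ks j).depth x ≤ D j) (hn : ∀ j β, (univ.filter fun x => (Ks j).blk x = β).card ≤ n j)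
    (k : ℕ) (w : Fin (k + 1) → St → ℝ) {a : Fin (k + 1) → ℝ} (ha : ∀ l, 0 ≤ a l) {amin wmin : ℝ}
    (hamin : 0 < amin) (hwmin : 0 < wmin) {ι : Type} [Fintype ι] {hs χs : ι → St → ℝ}
    (hsq : ∀ x, ∑ i, hs i x ^ 2 = 1) (hχ : ∀ i x, χs i x = 0 ∨ χs i x = 1)
    (h1 : ∀ i x, hs i x * χs i x = hs i x)
    (hconst : ∀ i x x', towerBlk Ks k x = towerBlk Ks k x' → χs i x = χs i x')
    (hD : ∀ i, mulOp (hs i ∘ Prod.fst) * (covDT src tgt c Rm ∘ₗ covD src tgt c Rm) * mulOp (χs i ∘ Prod.fst) =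
      mulOp (hs i ∘ Prod.fst) * (covDT src tgt c Rm ∘ₗ covD src tgt c Rm))
    (hcov : ∀ i x, χs i x = 1 → ∃ l : Fin (k + 1), amin ≤ a l ∧ wmin ≤ |w l (towerBlk Ks (l : ℕ) x)|) :
    Ring.inverse (towerOp Ks Rm c k (fun l x => w l (towerBlk Ks (l : ℕ) x)) a) =
      (∑ i, mulOp (hs i ∘ Prod.fst) *
          dirInv (towerOp Ks Rm c k (fun l x => w l (towerBlk Ks (l : ℕ) x)) a) (χs i ∘ Prod.fst) *
          mulOp (hs i ∘ Prod.fst)) +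
        Ring.inverse (towerOp Ks Rm c k (fun l x => w l (towerBlk Ks (l : ℕ) x)) a) *
          ∑ i, towerK Ks Rm c k (fun l x => w l (towerBlk Ks (l : ℕ) x)) a (hs i) *
            dirInv (towerOp Ks Rm c k (fun l x => w l (towerBlk Ks (l : ℕ) x)) a) (χs i ∘ Prod.fst) *
            mulOp (hs i ∘ Prod.fst) :=
  fixedPoint_of_388
    (inverse_mul_towerOp Ks Rm hRm hcmin hc hDp hn k w ha hamin hwmin fun x => by
      obtain ⟨i, hi⟩ := exists_region_of_pu hsq h1 x
      exact hcov i x hi)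
    (eq388_tower Ks Rm hRm hcmin hc hDp hn k w ha hamin hwmin hsq hχ h1 hconst hD hcov)

end Eq388

/-! ## §4  The torus: the lineage's partition of unity `hSU`, block hulls of balls as regions -/

section Torus

open B9Thm37GluePU (bsrc btgt hsq_torus)

variable {d : ℕ} {N : Fin d → ℕ} [∀ i, NeZero (N i)] [NeZero d]

omit [NeZero d] in
/-- M_0 = 0. [folklore] -/
theorem mulOp_zero_fun {X : Type} : mulOp (0 : X → ℝ) = 0 :=
  LinearMap.ext fun μ => funext fun x => by simp only [mulOp_apply, Pi.zero_apply, zero_mul, LinearMap.zero_apply]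

/-- MODEL: the region Ω₀(z) of the torus glue — the LEVEL-k BLOCK HULL (cube-comb tower of sides M_j) of the
(M₀+1)-ball round the centre z of the lineage's partition of unity (`B9Thm37GlueTorusInv.chiBall`): a union of
level-k blocks containing the ∇_U-neighbourhood of supp h_z (print's Ω₀(□), □̃⁴ ⊂ Ω₀(□) ⊂ □̃⁵, p. 408 — named only).
[cite: Balaban1985BackgroundPropagators, p.408 (Ω₀(□))] -/
def omegaBall {M : ℕ → ℕ} (hM : ∀ j, 1 ≤ M j) (hdiv : ∀ j i, M j ∣ N i) (k M₀ : ℕ) (z : Ctr N M₀) :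
    UT N → ℝ :=
  blkHull (torusTower hM hdiv) k (chiBall N M₀ z)

/-- Ω₀(z) is {0,1}-valued. [folklore] -/
theorem omegaBall_zero_or_one {M : ℕ → ℕ} (hM : ∀ j, 1 ≤ M j) (hdiv : ∀ j i, M j ∣ N i) (k M₀ : ℕ)
    (z : Ctr N M₀) (x : UT N) : omegaBall hM hdiv k M₀ z x = 0 ∨ omegaBall hM hdiv k M₀ z x = 1 :=
  blkHull_zero_or_one _ k _ x

/-- Ω₀(z) ⊇ the (M₀+1)-ball round z. [folklore] -/
theorem omegaBall_eq_one {M : ℕ → ℕ} (hM : ∀ j, 1 ≤ M j) (hdiv : ∀ j i, M j ∣ N i) (k M₀ : ℕ)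
    (z : Ctr N M₀) {x : UT N} (hx : dist x (ctrU N M₀ z) < M₀ + 1) : omegaBall hM hdiv k M₀ z x = 1 :=
  blkHull_eq_one _ k (by rw [chiBall_eq_one M₀ z x hx]; exact one_ne_zero)

/-- Ω₀(z) is constant on the level-k blocks. [folklore] -/
theorem omegaBall_const {M : ℕ → ℕ} (hM : ∀ j, 1 ≤ M j) (hdiv : ∀ j i, M j ∣ N i) (k M₀ : ℕ)
    (z : Ctr N M₀) (x x' : UT N)
    (h : towerBlk (torusTower hM hdiv) k x = towerBlk (torusTower hM hdiv) k x') :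
    omegaBall hM hdiv k M₀ z x = omegaBall hM hdiv k M₀ z x' :=
  blkHull_const _ k _ x x' h

/-- **D\*D-locality of the torus glue**: h_z·(∇_U\*∇_U)·Ω₀(z) = h_z·(∇_U\*∇_U) — ∇_U\*∇_U couples nearest
neighbours only and Ω₀(z) = 1 on the (M₀+1)-ball ⊇ the 1-neighbourhood of supp h_z
(`B9Thm37GlueTorusInv.mulOp_hSU_covLapQ_mulOp` with q = 0). [cite: Balaban1985BackgroundPropagators, (3.3) pp.390–391 + p.408 (Ω₀(□))] -/
theorem hD_torus {Cp : Type} [Fintype Cp] [DecidableEq Cp] {M : ℕ → ℕ} (hM : ∀ j, 1 ≤ M j)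
    (hdiv : ∀ j i, M j ∣ N i) (k : ℕ) {M₀ : ℕ} (hM₀ : 1 ≤ M₀) (z : Ctr N M₀) (c : UT N × Fin d → ℝ)
    (Rm : UT N × Fin d → Cp → Cp → ℝ) :
    mulOp (hSU N M₀ z ∘ Prod.fst) * (covDT bsrc btgt c Rm ∘ₗ covD bsrc btgt c Rm) *
        mulOp (omegaBall hM hdiv k M₀ z ∘ Prod.fst) =
      mulOp (hSU N M₀ z ∘ Prod.fst) * (covDT bsrc btgt c Rm ∘ₗ covD bsrc btgt c Rm) := by
  have h := mulOp_hSU_covLapQ_mulOp hM₀ z c Rm (0 : UT N × Cp → ℝ)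
    (fun x hx => omegaBall_eq_one hM hdiv k M₀ z hx)
  rwa [mulOp_zero_fun, add_zero] at h

/-- **"Δ′_aG′₀ = I − Σ_z K(h_z)G′_zh_z" ON THE TORUS WITH THE LINEAGE'S PARTITION OF UNITY** h_z = `hSU N M₀ z`
([3] (1.118); Σ_z h_z² = 1 EXACT for M₀ ∣ N_i, 2M₀ ≤ N_i) and the tower operator's OWN Dirichlet inverses
G′_z := `dirInv Δ′ Ω₀(z)`, Ω₀(z) = `omegaBall` (level-k block hull of the (M₀+1)-ball), K(h) CONCRETE (`towerK`):
the ONLY hypothesis beyond the data is the cover of each Ω₀(z) by the levels.  Algebra + existence; NO smallness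
of the remainder. [cite: Balaban1985BackgroundPropagators, (3.87)–(3.88) pp.408–409 + p.394 + (3.16) p.393; Balaban1984PropagatorsI, (1.118) p.36] -/
theorem eq388_tower_torus {Cp : Type} [Fintype Cp] [DecidableEq Cp] {M : ℕ → ℕ} (hM : ∀ j, 1 ≤ M j)
    (hdiv : ∀ j i, M j ∣ N i) {Rm : UT N × Fin d → Cp → Cp → ℝ}
    (hRm : ∀ b i j, ∑ k, Rm b k i * Rm b k j = if i = j then (1 : ℝ) else 0) {c : UT N × Fin d → ℝ}
    {cmin : ℝ} (hcmin : 0 < cmin) (hc : ∀ b, cmin ≤ |c b|) (k : ℕ) (w : Fin (k + 1) → UT N → ℝ)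
    {a : Fin (k + 1) → ℝ} (ha : ∀ l, 0 ≤ a l) {amin wmin : ℝ} (hamin : 0 < amin) (hwmin : 0 < wmin)
    {M₀ : ℕ} (hM₀ : 1 ≤ M₀) (hdiv₀ : ∀ i, M₀ ∣ N i) (h2N : ∀ i, 2 * M₀ ≤ N i)
    (hcov : ∀ (z : Ctr N M₀) (x : UT N), omegaBall hM hdiv k M₀ z x = 1 → ∃ l : Fin (k + 1), amin ≤ a l ∧
      wmin ≤ |w l (towerBlk (torusTower hM hdiv) (l : ℕ) x)|) :
    towerOp (torusTower hM hdiv) Rm c k (fun l x => w l (towerBlk (torusTower hM hdiv) (l : ℕ) x)) a *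
        (∑ z : Ctr N M₀, mulOp (hSU N M₀ z ∘ Prod.fst) *
          dirInv (towerOp (torusTower hM hdiv) Rm c k
            (fun l x => w l (towerBlk (torusTower hM hdiv) (l : ℕ) x)) a) (omegaBall hM hdiv k M₀ z ∘ Prod.fst) *
          mulOp (hSU N M₀ z ∘ Prod.fst)) =
      1 - ∑ z : Ctr N M₀, towerK (torusTower hM hdiv) Rm c k
          (fun l x => w l (towerBlk (torusTower hM hdiv) (l : ℕ) x)) a (hSU N M₀ z) *
        dirInv (towerOp (torusTower hM hdiv) Rm c k
          (fun l x => w l (towerBlk (torusTower hM hdiv) (l : ℕ) x)) a) (omegaBall hM hdiv k M₀ z ∘ Prod.fst) *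
        mulOp (hSU N M₀ z ∘ Prod.fst) :=
  eq388_tower (torusTower hM hdiv) Rm hRm hcmin hc (fun j x => tdepth_le (hM j) x)
    (fun j z => card_block_le (hM j) (hdiv j) z) k w ha hamin hwmin (hs := hSU N M₀)
    (χs := omegaBall hM hdiv k M₀) (hsq_torus hM₀ hdiv₀ h2N)
    (fun z x => omegaBall_zero_or_one hM hdiv k M₀ z x)
    (fun z x => hSU_mul_eq_of_one hM₀ z (fun _ hx => omegaBall_eq_one hM hdiv k M₀ z hx) x)
    (fun z x x' h => omegaBall_const hM hdiv k M₀ z x x' h) (fun z => hD_torus hM hdiv k hM₀ z c Rm) hcov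

/-- **THE FIXED-POINT FORM G′ = G′₀ + G′R′ ON THE TORUS** ((3.90) shape) for the tower operator, the lineage's
partition of unity and the block-hull regions: G′ = Δ′⁻¹ (a unit: the regions cover the torus), G′₀ = Σ_z h_zG′_zh_z,
R′ = Σ_z K(h_z)G′_zh_z.  NO smallness of R′ is asserted. [cite: Balaban1985BackgroundPropagators, (3.88)–(3.90) p.409 + p.394; Balaban1984PropagatorsI, (1.118) p.36] -/
theorem fixedPoint_tower_torus {Cp : Type} [Fintype Cp] [DecidableEq Cp] {M : ℕ → ℕ} (hM : ∀ j, 1 ≤ M j)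
    (hdiv : ∀ j i, M j ∣ N i) {Rm : UT N × Fin d → Cp → Cp → ℝ}
    (hRm : ∀ b i j, ∑ k, Rm b k i * Rm b k j = if i = j then (1 : ℝ) else 0) {c : UT N × Fin d → ℝ}
    {cmin : ℝ} (hcmin : 0 < cmin) (hc : ∀ b, cmin ≤ |c b|) (k : ℕ) (w : Fin (k + 1) → UT N → ℝ)
    {a : Fin (k + 1) → ℝ} (ha : ∀ l, 0 ≤ a l) {amin wmin : ℝ} (hamin : 0 < amin) (hwmin : 0 < wmin)
    {M₀ : ℕ} (hM₀ : 1 ≤ M₀) (hdiv₀ : ∀ i, M₀ ∣ N i) (h2N : ∀ i, 2 * M₀ ≤ N i)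
    (hcov : ∀ (z : Ctr N M₀) (x : UT N), omegaBall hM hdiv k M₀ z x = 1 → ∃ l : Fin (k + 1), amin ≤ a l ∧
      wmin ≤ |w l (towerBlk (torusTower hM hdiv) (l : ℕ) x)|) :
    Ring.inverse (towerOp (torusTower hM hdiv) Rm c k
        (fun l x => w l (towerBlk (torusTower hM hdiv) (l : ℕ) x)) a) =
      (∑ z : Ctr N M₀, mulOp (hSU N M₀ z ∘ Prod.fst) *
          dirInv (towerOp (torusTower hM hdiv) Rm c k
            (fun l x => w l (towerBlk (torusTower hM hdiv) (l : ℕ) x)) a) (omegaBall hM hdiv k M₀ z ∘ Prod.fst) *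
          mulOp (hSU N M₀ z ∘ Prod.fst)) +
        Ring.inverse (towerOp (torusTower hM hdiv) Rm c k
            (fun l x => w l (towerBlk (torusTower hM hdiv) (l : ℕ) x)) a) *
          ∑ z : Ctr N M₀, towerK (torusTower hM hdiv) Rm c k
              (fun l x => w l (towerBlk (torusTower hM hdiv) (l : ℕ) x)) a (hSU N M₀ z) *
            dirInv (towerOp (torusTower hM hdiv) Rm c k
              (fun l x => w l (towerBlk (torusTower hM hdiv) (l : ℕ) x)) a) (omegaBall hM hdiv k M₀ z ∘ Prod.fst) *
            mulOp (hSU N M₀ z ∘ Prod.fst) :=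
  fixedPoint_tower (torusTower hM hdiv) Rm hRm hcmin hc (fun j x => tdepth_le (hM j) x)
    (fun j z => card_block_le (hM j) (hdiv j) z) k w ha hamin hwmin (hs := hSU N M₀)
    (χs := omegaBall hM hdiv k M₀) (hsq_torus hM₀ hdiv₀ h2N)
    (fun z x => omegaBall_zero_or_one hM hdiv k M₀ z x)
    (fun z x => hSU_mul_eq_of_one hM₀ z (fun _ hx => omegaBall_eq_one hM hdiv k M₀ z hx) x)
    (fun z x x' h => omegaBall_const hM hdiv k M₀ z x x' h) (fun z => hD_torus hM hdiv k hM₀ z c Rm) hcov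

/-- **NO HYPOTHESIS BEYOND THE DATA in the uniform-weight regime**: with block weights CONSTANT on each level
(w_l ≡ ω_l — print's averaging weights are uniform on blocks up to normalisation) and the top level switched on
(a_k ≥ a_min > 0, |ω_k| ≥ w_min > 0), every site is covered by level k itself, so `eq388_tower_torus` holds with
no cover hypothesis: Δ′·Σ_z h_zG′_zh_z = 1 − Σ_z K(h_z)G′_zh_z on the torus for the lineage's partition of unity.
Algebra + existence; NO smallness of the remainder. [cite: Balaban1985BackgroundPropagators, (3.87)–(3.88) pp.408–409 + (3.16) p.393; Balaban1984PropagatorsI, (1.118) p.36] -/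
theorem eq388_tower_torus_top {Cp : Type} [Fintype Cp] [DecidableEq Cp] {M : ℕ → ℕ} (hM : ∀ j, 1 ≤ M j)
    (hdiv : ∀ j i, M j ∣ N i) {Rm : UT N × Fin d → Cp → Cp → ℝ}
    (hRm : ∀ b i j, ∑ k, Rm b k i * Rm b k j = if i = j then (1 : ℝ) else 0) {c : UT N × Fin d → ℝ}
    {cmin : ℝ} (hcmin : 0 < cmin) (hc : ∀ b, cmin ≤ |c b|) (k : ℕ) (ω : Fin (k + 1) → ℝ)
    {a : Fin (k + 1) → ℝ} (ha : ∀ l, 0 ≤ a l) {amin wmin : ℝ} (hamin : 0 < amin) (hwmin : 0 < wmin)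
    (hak : amin ≤ a (Fin.last k)) (hωk : wmin ≤ |ω (Fin.last k)|)
    {M₀ : ℕ} (hM₀ : 1 ≤ M₀) (hdiv₀ : ∀ i, M₀ ∣ N i) (h2N : ∀ i, 2 * M₀ ≤ N i) :
    towerOp (torusTower hM hdiv) Rm c k (fun l _ => ω l) a *
        (∑ z : Ctr N M₀, mulOp (hSU N M₀ z ∘ Prod.fst) *
          dirInv (towerOp (torusTower hM hdiv) Rm c k (fun l _ => ω l) a) (omegaBall hM hdiv k M₀ z ∘ Prod.fst) *
          mulOp (hSU N M₀ z ∘ Prod.fst)) =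
      1 - ∑ z : Ctr N M₀, towerK (torusTower hM hdiv) Rm c k (fun l _ => ω l) a (hSU N M₀ z) *
        dirInv (towerOp (torusTower hM hdiv) Rm c k (fun l _ => ω l) a) (omegaBall hM hdiv k M₀ z ∘ Prod.fst) *
        mulOp (hSU N M₀ z ∘ Prod.fst) :=
  eq388_tower_torus hM hdiv hRm hcmin hc k (fun l _ => ω l) ha hamin hwmin hM₀ hdiv₀ h2N
    fun _ _ _ => ⟨Fin.last k, hak, hωk⟩

/-- **G′ = G′₀ + G′R′ ON THE TORUS WITH NO HYPOTHESIS BEYOND THE DATA** (uniform block weights, top level on):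
`fixedPoint_tower_torus` with the cover discharged by level k itself.  NO smallness of R′ is asserted.
[cite: Balaban1985BackgroundPropagators, (3.88)–(3.90) p.409 + (3.16) p.393; Balaban1984PropagatorsI, (1.118) p.36] -/
theorem fixedPoint_tower_torus_top {Cp : Type} [Fintype Cp] [DecidableEq Cp] {M : ℕ → ℕ} (hM : ∀ j, 1 ≤ M j)
    (hdiv : ∀ j i, M j ∣ N i) {Rm : UT N × Fin d → Cp → Cp → ℝ}
    (hRm : ∀ b i j, ∑ k, Rm b k i * Rm b k j = if i = j then (1 : ℝ) else 0) {c : UT N × Fin d → ℝ}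
    {cmin : ℝ} (hcmin : 0 < cmin) (hc : ∀ b, cmin ≤ |c b|) (k : ℕ) (ω : Fin (k + 1) → ℝ)
    {a : Fin (k + 1) → ℝ} (ha : ∀ l, 0 ≤ a l) {amin wmin : ℝ} (hamin : 0 < amin) (hwmin : 0 < wmin)
    (hak : amin ≤ a (Fin.last k)) (hωk : wmin ≤ |ω (Fin.last k)|)
    {M₀ : ℕ} (hM₀ : 1 ≤ M₀) (hdiv₀ : ∀ i, M₀ ∣ N i) (h2N : ∀ i, 2 * M₀ ≤ N i) :
    Ring.inverse (towerOp (torusTower hM hdiv) Rm c k (fun l _ => ω l) a) =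
      (∑ z : Ctr N M₀, mulOp (hSU N M₀ z ∘ Prod.fst) *
          dirInv (towerOp (torusTower hM hdiv) Rm c k (fun l _ => ω l) a) (omegaBall hM hdiv k M₀ z ∘ Prod.fst) *
          mulOp (hSU N M₀ z ∘ Prod.fst)) +
        Ring.inverse (towerOp (torusTower hM hdiv) Rm c k (fun l _ => ω l) a) *
          ∑ z : Ctr N M₀, towerK (torusTower hM hdiv) Rm c k (fun l _ => ω l) a (hSU N M₀ z) *
            dirInv (towerOp (torusTower hM hdiv) Rm c k (fun l _ => ω l) a)
              (omegaBall hM hdiv k M₀ z ∘ Prod.fst) *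
            mulOp (hSU N M₀ z ∘ Prod.fst) :=
  fixedPoint_tower_torus hM hdiv hRm hcmin hc k (fun l _ => ω l) ha hamin hwmin hM₀ hdiv₀ h2N
    fun _ _ _ => ⟨Fin.last k, hak, hωk⟩

end Torus

end

end Literature.MathematicalPhysics.QuantumFieldTheory.Balaban1983to89.B9Thm37GlueTorusCovTowerPU
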